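import Mathlib
import HarnessLib
import Summits.NavierStokesRegularity.NavierStokesRegularity.Theorems.HalfSpaceWindowDoorCirculationCarryingRigidityGaussTilting
import Summits.NavierStokesRegularity.NavierStokesRegularity.Theorems.HalfSpaceWindowDoorCirculationCarryingRigidityGaussProduct

/-!
# Route `HalfSpaceWindowDoor`, crux `CirculationCarryingRigidity` (stmt-NavierStokesRegularity-25311) — line «gauss-swirl»:
# the AXIS-AVERAGING LAW of the Gaussian inflow (the legal sum rule) and its census consequence
# «inflow is never uniform over axis positions»

LEAD ns-hsw-p1 g6 (cell pub-ns-dss), `--supports 25311 --as helper`.  The ideator's card (ns-idea-4 g11, LINE-gauss-swirl_v1_4.md §E(ii))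
states ON PAPER the semigroup identity over axis positions; this file TYPES and PROVES it.

* tools (`…GaussProduct`): the Gaussian product identity `G_T(z − y)·G_t(y) = G_{t+T}(z)·G_σ(y − m)` (`σ = tT/(t+T)`,
  `m = (t/(t+T))z`), shifted second moments, and the inner axis integrals
  `∫ G_T(x₀ − xc)G_t(x − x₀)⟪x−x₀,a⟫⟪x−x₀,b⟫dx₀ = G_{t+T}(x − xc)[(t/(t+T))²⟪x−xc,a⟫⟪x−xc,b⟫ + 2σ⟪a,b⟫]`;
* `angMom_eq_inner`, `inner_swirl_eq_zero` — `g = ⟪x − x₀, u₁e₀ − u₀e₁⟫` and `⟪u, u₁e₀ − u₀e₁⟫ = 0` (the trace term of the sum rule);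
* `integral_axisIntegrand`, `integrable_axisIntegrand_prod` (Fubini on `ℝ³ × ℝ³` with the explicit Gaussian-moment dominator);
* `integral_heatKernel_mul_gaussInflow` — **THE AXIS-AVERAGING LAW** (kinematic; any continuous bounded field `u`, any `t, T > 0`,
  any centre `xc`): `∫ G_T(x₀ − xc)·ℐ(t; x₀)[u] dx₀ = (t/(t+T))²·ℐ(t+T; xc)[u]` — averaging the Gaussian inflow correlation over
  axis positions at scale `T` IS the inflow correlation about the centre at the later scale `t + T`, damped by `(t/(t+T))²`.  The
  TRACE TERM of the product Gaussian drops out exactly because the swirl covector `a' = (a₁, −a₀, 0)` of `g = ⟪x−x₀, a'⟫` is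
  orthogonal to `a = u(x)` — the same algebraic fact as the ideator's zero-mean sum rule, in its absolutely convergent Gaussian form;
* `exists_axis_gaussInflow_ge` — **CENSUS CONSEQUENCE (no hypothesis beyond the door class):** for every door-class profile, every
  time `s < 0`, every scale `t > 0` and every `ε > 0` there is an axis `x₀` with `ℐ(t; x₀)[v(s)] ≥ −ε`: by the law and the inflow
  bound `|ℐ(t+T; xc)| ≤ (4π)^{3/2}·12C²·(t+T)/(−s)` (`…GaussTilting.abs_gaussInflow_le`) the Gaussian axis-average of `ℐ(t;·)` is
  `≥ −(4π)^{3/2}·12C²·t²/((t+T)(−s)) → 0` as `T → ∞`.  INFLOW IS NEVER UNIFORM OVER AXIS POSITIONS: the research statement K1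
  (`PersistentAxis` ⟺ W6) is a statement about PERSISTENCE IN TIME of one non-inflowing axis, never about existence at a fixed time.

WHAT THIS IS NOT: not a statement about Navier–Stokes regularity (Clay A); door statements are regularity CRITERIA about HYPOTHETICAL
blow-up profiles; K1 / W6 / item 25311 remain OPEN.
-/

noncomputable section

-- the summit and its single sub-problem share the name (CONVENTIONS §1), as in every Theorems file
set_option linter.dupNamespace false

namespace Summit.NavierStokesRegularity.NavierStokesRegularity.Theorems.HalfSpaceWindowDoorCirculationCarryingRigidityGaussAxisAverage

open scoped BigOperators Topology InnerProductSpace RealInnerProductSpace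
open Filter Set Function MeasureTheory
open Literature.Analysis Literature.Analysis.FluidPDE Literature.Analysis.UnboundedOperators
open Summit.NavierStokesRegularity.NavierStokesRegularity.Theorems.HalfSpaceWindowDoorCirculationCarryingRigidityDefs
open Summit.NavierStokesRegularity.NavierStokesRegularity.Theorems.HalfSpaceWindowDoorCirculationCarryingRigidityGaussKernel
open Summit.NavierStokesRegularity.NavierStokesRegularity.Theorems.HalfSpaceWindowDoorCirculationCarryingRigidityGaussTilting
  (abs_gaussInflow_le)
open Summit.NavierStokesRegularity.NavierStokesRegularity.Theorems.HalfSpaceWindowDoorCirculationCarryingRigidityGaussProduct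

/-! ### The swirl covector: `g = ⟪x − x₀, a'⟫` with `a' = a₁e₀ − a₀e₁ ⊥ a` -/

/-- The angular-momentum density is linear in `x − x₀`: `g = ⟪x − x₀, u₁e₀ − u₀e₁⟫`. -/
theorem angMom_eq_inner (x₀ : EuclideanSpace ℝ (Fin 3)) (u : EuclideanSpace ℝ (Fin 3) → EuclideanSpace ℝ (Fin 3))
    (x : EuclideanSpace ℝ (Fin 3)) :
    angMom x₀ u x = ⟪x - x₀, (u x 1) • EuclideanSpace.single (0 : Fin 3) (1 : ℝ) -
      (u x 0) • EuclideanSpace.single (1 : Fin 3) (1 : ℝ)⟫ := by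
  rw [angMom, inner_sub_right, real_inner_smul_right, real_inner_smul_right, EuclideanSpace.inner_single_right,
    EuclideanSpace.inner_single_right]
  simp only [RCLike.conj_to_real, one_mul]
  ring

/-- The swirl covector is orthogonal to the velocity: `⟪a, a₁e₀ − a₀e₁⟫ = 0` (the trace term of the sum rule vanishes). -/
theorem inner_swirl_eq_zero (a : EuclideanSpace ℝ (Fin 3)) :
    ⟪a, (a 1) • EuclideanSpace.single (0 : Fin 3) (1 : ℝ) - (a 0) • EuclideanSpace.single (1 : Fin 3) (1 : ℝ)⟫ = 0 := by
  rw [inner_sub_right, real_inner_smul_right, real_inner_smul_right, EuclideanSpace.inner_single_right,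
    EuclideanSpace.inner_single_right]
  simp only [RCLike.conj_to_real, one_mul]
  ring

/-! ### The axis integrand and its inner integral -/

section Axis

variable {u : EuclideanSpace ℝ (Fin 3) → EuclideanSpace ℝ (Fin 3)} {t T : ℝ} (xc : EuclideanSpace ℝ (Fin 3))

/-- The axis integrand in kernel form:
`G_T(x₀ − xc)·gauss_t(x₀,x)·⟪x−x₀,u⟫·g = (4πt)^{3/2}·G_T(x₀ − xc)·G_t(x − x₀)·⟪x−x₀,u(x)⟫⟪x−x₀,u₁e₀−u₀e₁⟫`. -/
theorem axisIntegrand_eq (ht : 0 < t) (x x₀ : EuclideanSpace ℝ (Fin 3)) :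
    heatKernel T (x₀ - xc) * (gauss t x₀ x * (⟪x - x₀, u x⟫ * angMom x₀ u x)) =
      (4 * Real.pi * t) ^ ((3 : ℝ) / 2) * (heatKernel T (x₀ - xc) * (heatKernel t (x - x₀) *
        (⟪x - x₀, u x⟫ * ⟪x - x₀, (u x 1) • EuclideanSpace.single (0 : Fin 3) (1 : ℝ) -
          (u x 0) • EuclideanSpace.single (1 : Fin 3) (1 : ℝ)⟫))) := by
  rw [gauss_eq_heatKernel ht, angMom_eq_inner]
  ring

/-- **Inner axis integral of the inflow integrand**: the trace term drops out (`⟪u, u₁e₀ − u₀e₁⟫ = 0`), leaving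
`(4πt)^{3/2}·G_{t+T}(x − xc)·(t/(t+T))²·⟪x − xc, u(x)⟫·g_{xc}(x)`. -/
theorem integral_axisIntegrand (ht : 0 < t) (hT : 0 < T) (x : EuclideanSpace ℝ (Fin 3)) :
    ∫ x₀ : EuclideanSpace ℝ (Fin 3), heatKernel T (x₀ - xc) * (gauss t x₀ x * (⟪x - x₀, u x⟫ * angMom x₀ u x)) =
      (4 * Real.pi * t) ^ ((3 : ℝ) / 2) *
        (heatKernel (t + T) (x - xc) * ((t / (t + T)) ^ 2 * (⟪x - xc, u x⟫ * angMom xc u x))) := by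
  simp_rw [axisIntegrand_eq xc ht x]
  rw [integral_const_mul, integral_axis_heatKernel_mul_inner_mul_inner ht hT, inner_swirl_eq_zero, mul_zero, add_zero,
    ← angMom_eq_inner]

/-- Size of the axis integrand: `≤ 2B²(4πt)^{3/2}·G_T(x₀ − xc)·G_t(x − x₀)‖x − x₀‖²` when `‖u‖ ≤ B`. -/
theorem norm_axisIntegrand_le (ht : 0 < t) (hT : 0 < T) {B : ℝ} (hB : ∀ x, ‖u x‖ ≤ B) (x x₀ : EuclideanSpace ℝ (Fin 3)) :
    ‖heatKernel T (x₀ - xc) * (gauss t x₀ x * (⟪x - x₀, u x⟫ * angMom x₀ u x))‖ ≤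
      2 * B ^ 2 * (4 * Real.pi * t) ^ ((3 : ℝ) / 2) *
        (heatKernel T (x₀ - xc) * (heatKernel t (x - x₀) * ‖x - x₀‖ ^ 2)) := by
  have hB0 : 0 ≤ B := (norm_nonneg _).trans (hB x)
  have hGT : 0 ≤ heatKernel T (x₀ - xc) := (heatKernel_pos hT _).le
  have hGt : 0 ≤ heatKernel t (x - x₀) := (heatKernel_pos ht _).le
  have hg0 : 0 ≤ gauss t x₀ x := (Real.exp_pos _).le
  rw [Real.norm_eq_abs]
  simp only [abs_mul]
  rw [abs_of_nonneg hGT, abs_of_nonneg hg0, gauss_eq_heatKernel ht]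
  have h1 : |⟪x - x₀, u x⟫| ≤ ‖x - x₀‖ * B := (abs_real_inner_le_norm _ _).trans (by gcongr; exact hB x)
  have h2 : |angMom x₀ u x| ≤ 2 * ‖x - x₀‖ * B :=
    (abs_angMom_le x₀ u x).trans (by gcongr; exact hB x)
  calc heatKernel T (x₀ - xc) * ((4 * Real.pi * t) ^ ((3 : ℝ) / 2) * heatKernel t (x - x₀) * (|⟪x - x₀, u x⟫| * |angMom x₀ u x|))
      ≤ heatKernel T (x₀ - xc) * ((4 * Real.pi * t) ^ ((3 : ℝ) / 2) * heatKernel t (x - x₀) *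
          ((‖x - x₀‖ * B) * (2 * ‖x - x₀‖ * B))) := by
        gcongr heatKernel T (x₀ - xc) * ((4 * Real.pi * t) ^ ((3 : ℝ) / 2) * heatKernel t (x - x₀) * ?_)
        exact mul_le_mul h1 h2 (abs_nonneg _) (by positivity)
    _ = 2 * B ^ 2 * (4 * Real.pi * t) ^ ((3 : ℝ) / 2) * (heatKernel T (x₀ - xc) * (heatKernel t (x - x₀) * ‖x - x₀‖ ^ 2)) := by
        ring

/-- The dominating function `G_T(x₀ − xc)·G_t(x − x₀)‖x − x₀‖²` is integrable in the axis position `x₀`. -/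
theorem integrable_axis_dominator (ht : 0 < t) (hT : 0 < T) (x : EuclideanSpace ℝ (Fin 3)) :
    Integrable fun x₀ : EuclideanSpace ℝ (Fin 3) => heatKernel T (x₀ - xc) * (heatKernel t (x - x₀) * ‖x - x₀‖ ^ 2) := by
  -- `G_t ≤ (4πt)^{-3/2}` and `‖x − x₀‖² ≤ 2‖x₀ − xc‖² + 2‖x − xc‖²`
  have hc : (0 : ℝ) < (4 * Real.pi * t) ^ (-((3 : ℕ) : ℝ) / 2) := by positivity
  refine Integrable.mono'
    ((((integrable_norm_sq_mul_G xc hT).const_mul 2).add ((integrable_G xc hT).const_mul (2 * ‖x - xc‖ ^ 2))).const_mul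
      ((4 * Real.pi * t) ^ (-((3 : ℕ) : ℝ) / 2)))
    (((continuous_G xc T).mul (((continuous_heatKernel t).comp (continuous_const.sub continuous_id)).mul
      ((continuous_const.sub continuous_id).norm.pow 2))).aestronglyMeasurable)
    (Eventually.of_forall fun x₀ => ?_)
  have hGT : 0 ≤ heatKernel T (x₀ - xc) := (heatKernel_pos hT _).le
  have hGt : 0 ≤ heatKernel t (x - x₀) := (heatKernel_pos ht _).le
  have hGt' : heatKernel t (x - x₀) ≤ (4 * Real.pi * t) ^ (-((3 : ℕ) : ℝ) / 2) := by
    unfold heatKernel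
    rw [finrank_euclideanSpace_fin]
    have : Real.exp (-‖x - x₀‖ ^ 2 / (4 * t)) ≤ 1 := Real.exp_le_one_iff.2 (by
      rw [neg_div]
      exact neg_nonpos.2 (by positivity))
    calc (4 * Real.pi * t) ^ (-((3 : ℕ) : ℝ) / 2) * Real.exp (-‖x - x₀‖ ^ 2 / (4 * t))
        ≤ (4 * Real.pi * t) ^ (-((3 : ℕ) : ℝ) / 2) * 1 := by gcongr
      _ = _ := mul_one _
  have hsq : ‖x - x₀‖ ^ 2 ≤ 2 * ‖x₀ - xc‖ ^ 2 + 2 * ‖x - xc‖ ^ 2 := by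
    have : ‖x - x₀‖ ≤ ‖x - xc‖ + ‖x₀ - xc‖ := by
      calc ‖x - x₀‖ = ‖(x - xc) - (x₀ - xc)‖ := by rw [sub_sub_sub_cancel_right]
        _ ≤ ‖x - xc‖ + ‖x₀ - xc‖ := norm_sub_le _ _
    have h1 : ‖x - x₀‖ ^ 2 ≤ (‖x - xc‖ + ‖x₀ - xc‖) ^ 2 := pow_le_pow_left₀ (norm_nonneg _) this 2
    nlinarith [sq_nonneg (‖x - xc‖ - ‖x₀ - xc‖)]
  rw [Real.norm_eq_abs, abs_of_nonneg (by positivity)]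
  calc heatKernel T (x₀ - xc) * (heatKernel t (x - x₀) * ‖x - x₀‖ ^ 2)
      ≤ heatKernel T (x₀ - xc) * ((4 * Real.pi * t) ^ (-((3 : ℕ) : ℝ) / 2) * (2 * ‖x₀ - xc‖ ^ 2 + 2 * ‖x - xc‖ ^ 2)) := by
        gcongr heatKernel T (x₀ - xc) * ?_
        exact mul_le_mul hGt' hsq (by positivity) hc.le
    _ = (4 * Real.pi * t) ^ (-((3 : ℕ) : ℝ) / 2) *
          (2 * (‖x₀ - xc‖ ^ 2 * heatKernel T (x₀ - xc)) + 2 * ‖x - xc‖ ^ 2 * heatKernel T (x₀ - xc)) := by ring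

/-- The axis integrand is integrable in the axis position `x₀` (for every `x`). -/
theorem integrable_axisIntegrand (ht : 0 < t) (hT : 0 < T) {B : ℝ} (hB : ∀ x, ‖u x‖ ≤ B)
    (x : EuclideanSpace ℝ (Fin 3)) :
    Integrable fun x₀ : EuclideanSpace ℝ (Fin 3) =>
      heatKernel T (x₀ - xc) * (gauss t x₀ x * (⟪x - x₀, u x⟫ * angMom x₀ u x)) := by
  refine Integrable.mono' ((integrable_axis_dominator xc ht hT x).const_mul (2 * B ^ 2 * (4 * Real.pi * t) ^ ((3 : ℝ) / 2)))
    ?_ (Eventually.of_forall fun x₀ => norm_axisIntegrand_le xc ht hT hB x x₀)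
  have hg : Continuous fun x₀ : EuclideanSpace ℝ (Fin 3) => gauss t x₀ x := by
    unfold gauss
    exact (((continuous_const.sub continuous_id).norm.pow 2).neg.div_const _).rexp
  have ha : Continuous fun x₀ : EuclideanSpace ℝ (Fin 3) => angMom x₀ u x := by
    unfold angMom
    fun_prop
  exact ((continuous_G xc T).mul (hg.mul (((continuous_const.sub continuous_id).inner continuous_const).mul ha))).aestronglyMeasurable

end Axis

/-! ### Fubini: the axis integrand is integrable on `ℝ³ × ℝ³` -/

section Law

variable {u : EuclideanSpace ℝ (Fin 3) → EuclideanSpace ℝ (Fin 3)} {t T : ℝ}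

/-- Joint continuity of the axis integrand `H(x, x₀)`. -/
theorem continuous_axisIntegrand (hu : Continuous u) (t T : ℝ) (xc : EuclideanSpace ℝ (Fin 3)) :
    Continuous fun p : EuclideanSpace ℝ (Fin 3) × EuclideanSpace ℝ (Fin 3) =>
      heatKernel T (p.2 - xc) * (gauss t p.2 p.1 * (⟪p.1 - p.2, u p.1⟫ * angMom p.2 u p.1)) := by
  have h1 : Continuous fun p : EuclideanSpace ℝ (Fin 3) × EuclideanSpace ℝ (Fin 3) => heatKernel T (p.2 - xc) :=
    (continuous_heatKernel T).comp (continuous_snd.sub continuous_const)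
  have h2 : Continuous fun p : EuclideanSpace ℝ (Fin 3) × EuclideanSpace ℝ (Fin 3) => gauss t p.2 p.1 := by
    unfold gauss
    exact (((continuous_fst.sub continuous_snd).norm.pow 2).neg.div_const _).rexp
  have h3 : Continuous fun p : EuclideanSpace ℝ (Fin 3) × EuclideanSpace ℝ (Fin 3) => ⟪p.1 - p.2, u p.1⟫ :=
    (continuous_fst.sub continuous_snd).inner (hu.comp continuous_fst)
  have hc : ∀ (W : EuclideanSpace ℝ (Fin 3) × EuclideanSpace ℝ (Fin 3) → EuclideanSpace ℝ (Fin 3)), Continuous W →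
      ∀ i : Fin 3, Continuous fun p => W p i :=
    fun W hW i => (EuclideanSpace.proj i).continuous.comp hW
  have h4 : Continuous fun p : EuclideanSpace ℝ (Fin 3) × EuclideanSpace ℝ (Fin 3) => angMom p.2 u p.1 := by
    unfold angMom
    exact ((hc _ (continuous_fst.sub continuous_snd) 0).mul (hc _ (hu.comp continuous_fst) 1)).sub
      ((hc _ (continuous_fst.sub continuous_snd) 1).mul (hc _ (hu.comp continuous_fst) 0))
  exact h1.mul (h2.mul (h3.mul h4))

/-- **Fubini integrability.**  For a continuous bounded field the axis integrand `H(x, x₀)` is integrable on `ℝ³ × ℝ³`. -/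
theorem integrable_axisIntegrand_prod (hu : Continuous u) {B : ℝ} (hB : ∀ x, ‖u x‖ ≤ B) (ht : 0 < t) (hT : 0 < T)
    (xc : EuclideanSpace ℝ (Fin 3)) :
    Integrable (fun p : EuclideanSpace ℝ (Fin 3) × EuclideanSpace ℝ (Fin 3) =>
      heatKernel T (p.2 - xc) * (gauss t p.2 p.1 * (⟪p.1 - p.2, u p.1⟫ * angMom p.2 u p.1))) (volume.prod volume) := by
  have htT : 0 < t + T := by linarith
  have hσ : 0 ≤ t * T / (t + T) := by positivity
  have hB0 : 0 ≤ B := (norm_nonneg _).trans (hB 0)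
  have hmeas : AEStronglyMeasurable (fun p : EuclideanSpace ℝ (Fin 3) × EuclideanSpace ℝ (Fin 3) =>
      heatKernel T (p.2 - xc) * (gauss t p.2 p.1 * (⟪p.1 - p.2, u p.1⟫ * angMom p.2 u p.1))) (volume.prod volume) :=
    (continuous_axisIntegrand hu t T xc).aestronglyMeasurable
  rw [integrable_prod_iff hmeas]
  refine ⟨Eventually.of_forall fun x => integrable_axisIntegrand xc ht hT hB x, ?_⟩
  -- dominate `x ↦ ∫‖H(x,x₀)‖dx₀` by an explicit Gaussian moment of `x`
  set c : ℝ := 2 * B ^ 2 * (4 * Real.pi * t) ^ ((3 : ℝ) / 2) with hc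
  have hc0 : 0 ≤ c := by positivity
  refine Integrable.mono'
    ((((integrable_norm_sq_mul_G xc htT).const_mul ((t / (t + T)) ^ 2)).add
      ((integrable_G xc htT).const_mul (6 * (t * T / (t + T))))).const_mul c)
    hmeas.norm.integral_prod_right' (Eventually.of_forall fun x => ?_)
  have hIn : Integrable fun x₀ : EuclideanSpace ℝ (Fin 3) =>
      ‖heatKernel T (x₀ - xc) * (gauss t x₀ x * (⟪x - x₀, u x⟫ * angMom x₀ u x))‖ :=
    (integrable_axisIntegrand xc ht hT hB x).norm
  have hnn : 0 ≤ ∫ x₀ : EuclideanSpace ℝ (Fin 3), ‖heatKernel T (x₀ - xc) * (gauss t x₀ x * (⟪x - x₀, u x⟫ * angMom x₀ u x))‖ :=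
    integral_nonneg fun _ => norm_nonneg _
  rw [Real.norm_eq_abs, abs_of_nonneg hnn]
  calc ∫ x₀ : EuclideanSpace ℝ (Fin 3), ‖heatKernel T (x₀ - xc) * (gauss t x₀ x * (⟪x - x₀, u x⟫ * angMom x₀ u x))‖
      ≤ ∫ x₀ : EuclideanSpace ℝ (Fin 3), c * (heatKernel T (x₀ - xc) * (heatKernel t (x - x₀) * ‖x - x₀‖ ^ 2)) :=
        integral_mono hIn ((integrable_axis_dominator xc ht hT x).const_mul c)
          fun x₀ => norm_axisIntegrand_le xc ht hT hB x x₀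
    _ = c * (heatKernel (t + T) (x - xc) * ((t / (t + T)) ^ 2 * ‖x - xc‖ ^ 2 + 6 * (t * T / (t + T)))) := by
        rw [integral_const_mul, integral_axis_heatKernel_mul_norm_sq ht hT]
    _ = c * ((t / (t + T)) ^ 2 * (‖x - xc‖ ^ 2 * heatKernel (t + T) (x - xc)) +
          6 * (t * T / (t + T)) * heatKernel (t + T) (x - xc)) := by ring

/-! ### The axis-averaging law -/

/-- **THE AXIS-AVERAGING LAW of the Gaussian inflow (kinematic).**  For every continuous bounded field `u`, all scales
`t, T > 0` and every centre `xc`:  `∫ G_T(x₀ − xc)·ℐ(t; x₀)[u] dx₀ = (t/(t+T))²·ℐ(t+T; xc)[u]`. -/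
theorem integral_heatKernel_mul_gaussInflow (hu : Continuous u) {B : ℝ} (hB : ∀ x, ‖u x‖ ≤ B) (ht : 0 < t) (hT : 0 < T)
    (xc : EuclideanSpace ℝ (Fin 3)) :
    ∫ x₀ : EuclideanSpace ℝ (Fin 3), heatKernel T (x₀ - xc) * gaussInflow t x₀ u =
      (t / (t + T)) ^ 2 * gaussInflow (t + T) xc u := by
  have htT : 0 < t + T := by linarith
  -- LHS: constant out, Fubini, inner axis integral
  have hL : ∀ x₀ : EuclideanSpace ℝ (Fin 3), heatKernel T (x₀ - xc) * gaussInflow t x₀ u =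
      t ^ (-(3 : ℝ) / 2) * ∫ x : EuclideanSpace ℝ (Fin 3),
        heatKernel T (x₀ - xc) * (gauss t x₀ x * (⟪x - x₀, u x⟫ * angMom x₀ u x)) := by
    intro x₀
    unfold gaussInflow
    rw [mul_left_comm, ← integral_const_mul (heatKernel T (x₀ - xc))]
  simp_rw [hL]
  rw [integral_const_mul]
  have hInt := integrable_axisIntegrand_prod hu hB ht hT xc
  have hswap := integral_integral_swap (μ := (volume : Measure (EuclideanSpace ℝ (Fin 3))))
    (ν := (volume : Measure (EuclideanSpace ℝ (Fin 3))))
    (f := fun (x₀ x : EuclideanSpace ℝ (Fin 3)) =>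
      heatKernel T (x₀ - xc) * (gauss t x₀ x * (⟪x - x₀, u x⟫ * angMom x₀ u x))) hInt.swap
  rw [hswap]
  simp_rw [integral_axisIntegrand xc ht hT]
  rw [integral_const_mul]
  have hI : ∀ x : EuclideanSpace ℝ (Fin 3),
      heatKernel (t + T) (x - xc) * ((t / (t + T)) ^ 2 * (⟪x - xc, u x⟫ * angMom xc u x)) =
        (t / (t + T)) ^ 2 * (heatKernel (t + T) (x - xc) * (⟪x - xc, u x⟫ * angMom xc u x)) := fun x => by ring
  simp_rw [hI]
  rw [integral_const_mul]
  -- RHS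
  unfold gaussInflow
  simp_rw [gauss_eq_heatKernel htT xc]
  have hJ : ∀ x : EuclideanSpace ℝ (Fin 3),
      (4 * Real.pi * (t + T)) ^ ((3 : ℝ) / 2) * heatKernel (t + T) (x - xc) * (⟪x - xc, u x⟫ * angMom xc u x) =
        (4 * Real.pi * (t + T)) ^ ((3 : ℝ) / 2) * (heatKernel (t + T) (x - xc) * (⟪x - xc, u x⟫ * angMom xc u x)) :=
    fun x => by ring
  simp_rw [hJ]
  rw [integral_const_mul]
  have h1 := rpow_scale ht
  have h2 := rpow_scale htT
  set I := ∫ x : EuclideanSpace ℝ (Fin 3), heatKernel (t + T) (x - xc) * (⟪x - xc, u x⟫ * angMom xc u x)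
  calc t ^ (-(3 : ℝ) / 2) * ((4 * Real.pi * t) ^ ((3 : ℝ) / 2) * ((t / (t + T)) ^ 2 * I))
      = (t ^ (-(3 : ℝ) / 2) * (4 * Real.pi * t) ^ ((3 : ℝ) / 2)) * ((t / (t + T)) ^ 2 * I) := by ring
    _ = ((t + T) ^ (-(3 : ℝ) / 2) * (4 * Real.pi * (t + T)) ^ ((3 : ℝ) / 2)) * ((t / (t + T)) ^ 2 * I) := by rw [h1, h2]
    _ = (t / (t + T)) ^ 2 * ((t + T) ^ (-(3 : ℝ) / 2) * ((4 * Real.pi * (t + T)) ^ ((3 : ℝ) / 2) * I)) := by ring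

/-- Integrability of the Gaussian-weighted inflow over axis positions, `x₀ ↦ G_T(x₀ − xc)·ℐ(t; x₀)[u]`. -/
theorem integrable_heatKernel_mul_gaussInflow (hu : Continuous u) {B : ℝ} (hB : ∀ x, ‖u x‖ ≤ B) (ht : 0 < t) (hT : 0 < T)
    (xc : EuclideanSpace ℝ (Fin 3)) :
    Integrable fun x₀ : EuclideanSpace ℝ (Fin 3) => heatKernel T (x₀ - xc) * gaussInflow t x₀ u := by
  have hInt := (integrable_axisIntegrand_prod hu hB ht hT xc).swap.integral_prod_left
  refine (hInt.const_mul (t ^ (-(3 : ℝ) / 2))).congr (Eventually.of_forall fun x₀ => ?_)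
  simp only [Function.comp, Prod.swap]
  unfold gaussInflow
  rw [mul_left_comm (heatKernel T (x₀ - xc)), ← integral_const_mul (heatKernel T (x₀ - xc))]

end Law

/-! ### Census consequence: inflow is never uniform over axis positions -/

/-- **INFLOW IS NEVER UNIFORM OVER AXIS POSITIONS (door class, no further hypothesis).**  For every profile of the route's
Type-I ancient Oseen-mild class, every time `s < 0`, every scale `t > 0` and every `ε > 0` there is an axis position `x₀` with
`ℐ(t; x₀)[v(s)] ≥ −ε`.  (The research statement K1 asks for ONE axis with `ℐ ≥ 0` at ALL times of a far-past ray — a persistence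
statement; existence at each fixed time and scale, up to `ε`, is free.) -/
theorem exists_axis_gaussInflow_ge {C : ℝ} {v : ℝ → EuclideanSpace ℝ (Fin 3) → EuclideanSpace ℝ (Fin 3)}
    (hv : InDoorClass C v) {t s ε : ℝ} (ht : 0 < t) (hs : s < 0) (hε : 0 < ε) :
    ∃ x₀ : EuclideanSpace ℝ (Fin 3), -ε ≤ gaussInflow t x₀ (v s) := by
  by_contra hcon
  push Not at hcon
  obtain ⟨hrate, hcont, -, -⟩ := id hv
  have hs0 : 0 < -s := by linarith
  -- the slice is continuous and bounded
  have hu : Continuous (v s) := by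
    have h := hcont.comp_continuous (continuous_const.prodMk continuous_id) fun x => ⟨hs, mem_univ _⟩
    exact h
  have hB : ∀ x, ‖v s x‖ ≤ C / Real.sqrt (-s) := fun x => hrate s hs x
  -- the scale `T`
  set K : ℝ := (4 * Real.pi) ^ ((3 : ℝ) / 2) * (12 * C ^ 2) with hK
  have hK0 : 0 ≤ K := by positivity
  set T : ℝ := t ^ 2 * K / (ε * (-s)) + 1 with hT
  have hT0 : 0 < T := by positivity
  have htT : 0 < t + T := by linarith
  -- the axis average is `> −ε` by the law and the inflow bound …
  have hlaw := integral_heatKernel_mul_gaussInflow hu hB ht hT0 (0 : EuclideanSpace ℝ (Fin 3))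
  have hbd := abs_gaussInflow_le hv (0 : EuclideanSpace ℝ (Fin 3)) htT hs
  have hlow : -ε < ∫ x₀ : EuclideanSpace ℝ (Fin 3), heatKernel T (x₀ - 0) * gaussInflow t x₀ (v s) := by
    rw [hlaw]
    have h1 : -(K * ((t + T) / (-s))) ≤ gaussInflow (t + T) 0 (v s) := by
      have := (abs_le.1 hbd).1
      simpa [hK] using this
    have h2 : (t / (t + T)) ^ 2 * (K * ((t + T) / (-s))) < ε := by
      rw [div_pow, div_mul_eq_mul_div, div_lt_iff₀ (by positivity)]
      have hT1 : t ^ 2 * K / (ε * (-s)) < T := by rw [hT]; linarith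
      have h3 : t ^ 2 * K < T * (ε * (-s)) := by rwa [div_lt_iff₀ (by positivity)] at hT1
      have h4 : t ^ 2 * (K * ((t + T) / (-s))) = (t ^ 2 * K) * (t + T) / (-s) := by ring
      rw [h4, div_lt_iff₀ hs0]
      nlinarith [sq_nonneg (t + T), mul_pos hε hs0, mul_pos ht hT0]
    nlinarith [h1, h2, sq_nonneg (t / (t + T))]
  -- … and `≤ −ε` by the pointwise bound
  have hI := integrable_heatKernel_mul_gaussInflow hu hB ht hT0 (0 : EuclideanSpace ℝ (Fin 3))
  have hG := (integrable_G (0 : EuclideanSpace ℝ (Fin 3)) hT0).const_mul (-ε)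
  have hup : ∫ x₀ : EuclideanSpace ℝ (Fin 3), heatKernel T (x₀ - 0) * gaussInflow t x₀ (v s) ≤
      ∫ x₀ : EuclideanSpace ℝ (Fin 3), -ε * heatKernel T (x₀ - 0) := by
    refine integral_mono hI hG fun x₀ => ?_
    have hGT : 0 ≤ heatKernel T (x₀ - 0) := (heatKernel_pos hT0 _).le
    have := (hcon x₀).le
    nlinarith
  rw [integral_const_mul] at hup
  have hone : ∫ x₀ : EuclideanSpace ℝ (Fin 3), heatKernel T (x₀ - 0) = 1 := by
    simp only [sub_zero]
    exact integral_heatKernel_eq_one_holds hT0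
  rw [hone, mul_one] at hup
  linarith

end Summit.NavierStokesRegularity.NavierStokesRegularity.Theorems.HalfSpaceWindowDoorCirculationCarryingRigidityGaussAxisAverage

end
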